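import Summits.Ventures.PercRepro.GenQFlatLatticeR

/-!
# PercRepro — the flat-lattice counting rows, part S: (G-B) at `q = 7` in the certificate vocabulary (night-4, gen 14)

`gb_row_seven`: the `q = 7` twin of part R's `gb_row_six` — the `j`-subsets of the hyperplane traces (`2 ≤ j`, simple `M`)
are of rank `6` or lie in a line / plane / solid / rank-`5` flat, through which at most `C(n − s, 4)` / `C(n − s, 3)` /
`C(n − s, 2)` / `C(n − s, 1)` hyperplanes with spanning traces pass — exactly the LP's row (G-B) at `q = 7` with the
ambient counts `Nl`, `NR 3`, `N4`, `NR 5` (the type-`6` certificates of `(9, 7)` at corank `≥ 19` quote it).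
Imports `GenQFlatLatticeR`.
-/
namespace PercRepro.Night4

open Finset ThmH SixFour GenQ PerFlat Star

variable {α : Type*} [DecidableEq α] {M : Matroid α} [M.Finite]

/-- **(G-B) at `q = 7` in the certificate vocabulary** (`2 ≤ j`, simple `M`). -/
theorem gb_row_seven (hs : Simple M) {G : Finset α} (hG : G ⊆ gr M) {j : ℕ} (hj : 2 ≤ j) :
    ∑ s ∈ Finset.range (G.card + 1), s.choose j * hypTr M G 6 s
      ≤ ∑ s ∈ Finset.range (G.card + 1), spSum M G 6 s j
        + ∑ s ∈ Finset.range (G.card + 1), (G.card - s).choose 4 * (s.choose j * Nl M G s)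
        + ∑ s ∈ Finset.range (G.card + 1), (G.card - s).choose 3 * (s.choose j * NR M G 3 s)
        + ∑ s ∈ Finset.range (G.card + 1), (G.card - s).choose 2 * (s.choose j * N4 M G s)
        + ∑ s ∈ Finset.range (G.card + 1), (G.card - s).choose 1 * (s.choose j * NR M G 5 s) := by
  have h := gb_row (M := M) (q := 7) hG (by norm_num) j
  have e6 : Finset.range (7 - 1) = {0, 1, 2, 3, 4, 5} := by decide
  rw [e6, Finset.sum_insert (by decide), Finset.sum_insert (by decide), Finset.sum_insert (by decide),
    Finset.sum_insert (by decide), Finset.sum_insert (by decide), Finset.sum_singleton] at h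
  simp only [Nat.reduceSub] at h
  refine h.trans ?_
  have h0 : ∀ ρ, ρ ≤ 1 → ∑ s ∈ Finset.range (G.card + 1),
      (G.card - s).choose (6 - ρ) * (s.choose j * hypTr M G ρ s) = 0 := by
    intro ρ hρ
    refine Finset.sum_eq_zero (fun s _ => ?_)
    rcases Nat.lt_or_ge s 2 with hlt | hge
    · rw [Nat.choose_eq_zero_of_lt (by omega : s < j), zero_mul, mul_zero]
    · rw [hypTr_eq_zero_of_le_one hs G hρ hge, mul_zero, mul_zero]
  have h2 : ∑ s ∈ Finset.range (G.card + 1), (G.card - s).choose 4 * (s.choose j * hypTr M G 2 s)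
      ≤ ∑ s ∈ Finset.range (G.card + 1), (G.card - s).choose 4 * (s.choose j * Nl M G s) :=
    Finset.sum_le_sum (fun s _ => Nat.mul_le_mul_left _ (Nat.mul_le_mul_left _
      ((hypTr_le_NR G 2 s).trans (le_of_eq (NR_two_eq_Nl G s)))))
  have h3 : ∑ s ∈ Finset.range (G.card + 1), (G.card - s).choose 3 * (s.choose j * hypTr M G 3 s)
      ≤ ∑ s ∈ Finset.range (G.card + 1), (G.card - s).choose 3 * (s.choose j * NR M G 3 s) :=
    Finset.sum_le_sum (fun s _ => Nat.mul_le_mul_left _ (Nat.mul_le_mul_left _ (hypTr_le_NR G 3 s)))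
  have h4 : ∑ s ∈ Finset.range (G.card + 1), (G.card - s).choose 2 * (s.choose j * hypTr M G 4 s)
      ≤ ∑ s ∈ Finset.range (G.card + 1), (G.card - s).choose 2 * (s.choose j * N4 M G s) :=
    Finset.sum_le_sum (fun s _ => Nat.mul_le_mul_left _ (Nat.mul_le_mul_left _
      ((hypTr_le_NR G 4 s).trans (le_of_eq (NR_four G s)))))
  have h5 : ∑ s ∈ Finset.range (G.card + 1), (G.card - s).choose 1 * (s.choose j * hypTr M G 5 s)
      ≤ ∑ s ∈ Finset.range (G.card + 1), (G.card - s).choose 1 * (s.choose j * NR M G 5 s) :=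
    Finset.sum_le_sum (fun s _ => Nat.mul_le_mul_left _ (Nat.mul_le_mul_left _ (hypTr_le_NR G 5 s)))
  have h00 := h0 0 (by norm_num)
  have h01 := h0 1 (by norm_num)
  simp only [Nat.reduceSub] at h00 h01
  omega

end PercRepro.Night4
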